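import Summits.CriticalPhenomena.PercolationContinuityZ3.Theorems.PercNearOneGluingNoHeavyLowerTailSahiOneStepAndLiteral
import Summits.CriticalPhenomena.PercolationContinuityZ3.Theorems.PercNearOneGluingNoHeavyLowerTailSahiE3DepthOneEvents
import HarnessLib

/-!
# One-step scheme: events that satisfy `(2′)` against EVERY increasing partner are closed under `x_e ∧ ·`

Prover prim-ineq-prove-3 gen 26 (`--supports stmt-CriticalPhenomena-4575`; memo
`run/shared/lean/prim/prim-ineq-prove-3/FINDING-G26C-NORMAL-FORM.md` §5).  No definitions, no sorries.

Call an increasing event `B` *universal* if `0 ≤ n(1_A, 1_B)` for the slot `{N_F ≥ t}` for ALL blocks `F`, levels `t` and increasing `A`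
(written out as a hypothesis; no definition is introduced).  Gen 20: every block threshold `{N_T ≥ r}` is universal.
* `osN_andLiteral_universal` — if `B` is universal and does not depend on `e`, then `{e ∈ ω} ∩ B` is universal (the AND-literal step
  `osN_threshold_andLiteral_step` when `e` is counted, the free step `osN_threshold_nonneg_of_sections` when it is not).
* `osN_monomialAnd_universal` — hence `{K ⊆ ω} ∩ B` is universal for every finite `K` avoiding the support of `B`.
* `osN_monomialAndBlockThreshold_nonneg`, **`sahiE3_monomialAndBlockThreshold_nonneg`** — Kahn C5 / Sahi `C₃`
  `0 ≤ E₃(1_{N_F ≥ t}, 1_A, 1_{x_K ∧ N_T ≥ r})` for all `F, t`, all disjoint `K, T`, all `r`, EVERY increasing `A`, every product measure.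
-/

noncomputable section

namespace Summit.CriticalPhenomena.PercolationContinuityZ3.Theorems

namespace SahiOneStep

open MeasureTheory Finset
open Literature.Probability.Percolation (DeterminedBy determinedBy_iff determinedBy_univ)
open Literature.Probability.LatticeModels (prodBernoulli sahiE3)
open Literature.Probability.Percolation.DecisionTree (ind)
open scoped Classical

variable {ι : Type*} [Fintype ι]

/-- **Universality is preserved by an AND-literal.**  If the increasing event `B` (determined by `SB`, `e ∉ SB`) satisfies `(2′)` against every
increasing partner for every threshold slot, then so does `{e ∈ ω} ∩ B`. [this work] -/
theorem osN_andLiteral_universal (p : ι → unitInterval) {B : Set (Set ι)} (hB : IsUpperSet B) {SB : Finset ι}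
    (hBS : DeterminedBy B (↑SB : Set ι)) {e : ι} (heB : e ∉ SB)
    (huniv : ∀ (F : Finset ι) (t : ℕ) (A : Set (Set ι)), IsUpperSet A →
      0 ≤ osN p {ω : Set ι | t ≤ (F.filter (· ∈ ω)).card} (ind A) (ind B))
    (F : Finset ι) (t : ℕ) {A : Set (Set ι)} (hA : IsUpperSet A) :
    0 ≤ osN p {ω : Set ι | t ≤ (F.filter (· ∈ ω)).card} (ind A) (ind ({ω : Set ι | e ∈ ω} ∩ B)) := by
  by_cases he : e ∈ F
  · rcases Nat.eq_zero_or_pos t with ht | ht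
    · subst ht
      have huniv' : {ω : Set ι | 0 ≤ (F.filter (· ∈ ω)).card} = Set.univ := by ext ω; simp
      rw [huniv', osN_ind_ind]
      simp only [Set.univ_inter, probReal_univ]
      ring_nf; exact le_rfl
    · obtain ⟨t', rfl⟩ : ∃ t', t = t' + 1 := ⟨t - 1, by omega⟩
      have hF : F = insert e (F.erase e) := (Finset.insert_erase he).symm
      rw [hF]
      exact osN_threshold_andLiteral_step p (F.notMem_erase e) t' hA hB hBS heB
        (huniv (F.erase e) t' _ (isUpperSet_section_insert hA e))
  · have hB1 : {ω : Set ι | insert e ω ∈ ({ω : Set ι | e ∈ ω} ∩ B)} = B := section_insert_and hBS heB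
    have hB0 : {ω : Set ι | ω \ {e} ∈ ({ω : Set ι | e ∈ ω} ∩ B)} = ∅ := section_sdiff_and B e
    have hBe : IsUpperSet ({ω : Set ι | e ∈ ω} ∩ B) :=
      IsUpperSet.inter (fun ω ω' (hle : ω ≤ ω') (h : e ∈ ω) => hle h) hB
    have z1 : ∀ X : Set (Set ι), osN p {ω : Set ι | t ≤ (F.filter (· ∈ ω)).card} (ind X) (ind (∅ : Set (Set ι))) = 0 := by
      intro X; rw [osN_ind_ind]; simp
    refine osN_threshold_nonneg_of_sections p F t hA hBe he ?_ ?_ ?_ ?_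
    · rw [hB1]; exact huniv F t _ (isUpperSet_section_insert hA e)
    · rw [hB0, z1]
    · rw [hB0, z1]
    · rw [hB1]; exact huniv F t _ (isUpperSet_section_sdiff hA e)

omit [Fintype ι] in
/-- Peeling one generator off a monomial: `{insert e K ⊆ ω} ∩ B = {e ∈ ω} ∩ ({K ⊆ ω} ∩ B)`. [folklore] -/
theorem supset_insert_inter (K : Finset ι) (e : ι) (B : Set (Set ι)) :
    {ω : Set ι | (↑(insert e K) : Set ι) ⊆ ω} ∩ B = {ω : Set ι | e ∈ ω} ∩ ({ω : Set ι | (↑K : Set ι) ⊆ ω} ∩ B) := by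
  ext ω
  simp only [Finset.coe_insert, Set.mem_inter_iff, Set.mem_setOf_eq, Set.insert_subset_iff]
  tauto

/-- **Universality is preserved by a monomial**: if `B` (determined by `SB`) is universal, so is `{K ⊆ ω} ∩ B` for every finite `K`
disjoint from `SB`. [this work] -/
theorem osN_monomialAnd_universal (p : ι → unitInterval) {B : Set (Set ι)} (hB : IsUpperSet B) {SB : Finset ι}
    (hBS : DeterminedBy B (↑SB : Set ι))
    (huniv : ∀ (F : Finset ι) (t : ℕ) (A : Set (Set ι)), IsUpperSet A →
      0 ≤ osN p {ω : Set ι | t ≤ (F.filter (· ∈ ω)).card} (ind A) (ind B)) :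
    ∀ (K : Finset ι), Disjoint K SB → ∀ (F : Finset ι) (t : ℕ) (A : Set (Set ι)), IsUpperSet A →
      0 ≤ osN p {ω : Set ι | t ≤ (F.filter (· ∈ ω)).card} (ind A) (ind ({ω : Set ι | (↑K : Set ι) ⊆ ω} ∩ B)) := by
  intro K
  induction K using Finset.induction with
  | empty =>
    intro _ F t A hA
    have : {ω : Set ι | (↑(∅ : Finset ι) : Set ι) ⊆ ω} ∩ B = B := by ext ω; simp
    rw [this]; exact huniv F t A hA
  | @insert e K heK ih =>
    intro hdisj F t A hA
    have hKd : Disjoint K SB := Finset.disjoint_of_subset_left (Finset.subset_insert e K) hdisj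
    have heSB : e ∉ SB := Finset.disjoint_left.1 hdisj (Finset.mem_insert_self e K)
    rw [supset_insert_inter]
    have hKB : IsUpperSet ({ω : Set ι | (↑K : Set ι) ⊆ ω} ∩ B) := (SahiHitting.isUpperSet_cyl K).inter hB
    -- the cylinder `{K ⊆ ω}` is determined by `K` (cf. `AdditiveGluingVar975.v975_det_subset`; re-proved locally to keep the import light)
    have hKdet : DeterminedBy {ω : Set ι | (↑K : Set ι) ⊆ ω} (↑K : Set ι) := by
      rw [determinedBy_iff]
      intro ω ω' h
      simp only [Set.mem_setOf_eq]
      constructor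
      · intro hK i hi
        have : i ∈ ω' ∩ ↑K := by rw [← h]; exact ⟨hK hi, hi⟩
        exact this.1
      · intro hK i hi
        have : i ∈ ω ∩ ↑K := by rw [h]; exact ⟨hK hi, hi⟩
        exact this.1
    have hKBS : DeterminedBy ({ω : Set ι | (↑K : Set ι) ⊆ ω} ∩ B) (↑(K ∪ SB) : Set ι) := by
      rw [Finset.coe_union]
      exact (hKdet.mono Set.subset_union_left).inter (hBS.mono Set.subset_union_right)
    have heKS : e ∉ K ∪ SB := by rw [Finset.mem_union, not_or]; exact ⟨heK, heSB⟩
    exact osN_andLiteral_universal p hKB hKBS heKS (fun F' t' A' hA' => ih hKd F' t' A' hA') F t hA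

/-- **`(2′)` for `B = x_K ∧ Th_r(T)` against every increasing `A`** (all `F, t`; `K ∩ T = ∅`; every product measure). [this work] -/
theorem osN_monomialAndBlockThreshold_nonneg (p : ι → unitInterval) (F : Finset ι) (t : ℕ) {K T : Finset ι} (hKT : Disjoint K T) (r : ℕ)
    {A : Set (Set ι)} (hA : IsUpperSet A) :
    0 ≤ osN p {ω : Set ι | t ≤ (F.filter (· ∈ ω)).card} (ind A)
      (ind ({ω : Set ι | (↑K : Set ι) ⊆ ω} ∩ {ω : Set ι | r ≤ (T.filter (· ∈ ω)).card})) :=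
  osN_monomialAnd_universal p (isUpperSet_threshold T r) (determinedBy_threshold T r)
    (fun F' t' _ hA' => osN_threshold_blockThreshold_nonneg p F' t' _ T r rfl hA') K hKT F t A hA

/-- **KAHN C5 / SAHI `C₃` for {threshold slot, ARBITRARY increasing event, monomial ∧ block threshold}.**  For every product measure, all
blocks `F, T`, every finite `K` disjoint from `T`, all `t, r` and EVERY increasing `A`:  `0 ≤ E₃(1_{N_F ≥ t}, 1_A, 1_{x_K ∧ N_T ≥ r})`. [this work] -/
theorem sahiE3_monomialAndBlockThreshold_nonneg (p : ι → unitInterval) (F : Finset ι) (t : ℕ) {K T : Finset ι} (hKT : Disjoint K T) (r : ℕ)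
    {A : Set (Set ι)} (hA : IsUpperSet A) :
    0 ≤ sahiE3 (prodBernoulli p) {ω : Set ι | t ≤ (F.filter (· ∈ ω)).card} A
      ({ω : Set ι | (↑K : Set ι) ⊆ ω} ∩ {ω : Set ι | r ≤ (T.filter (· ∈ ω)).card}) := by
  have hB : IsUpperSet ({ω : Set ι | (↑K : Set ι) ⊆ ω} ∩ {ω : Set ι | r ≤ (T.filter (· ∈ ω)).card}) :=
    (SahiHitting.isUpperSet_cyl K).inter (isUpperSet_threshold T r)
  rw [← osT_ind_ind, osT_eq_osMp_add_osN]
  exact add_nonneg (osMp_threshold_nonneg_all p F t hA hB) (osN_monomialAndBlockThreshold_nonneg p F t hKT r hA)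

end SahiOneStep

end Summit.CriticalPhenomena.PercolationContinuityZ3.Theorems
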